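import Summits.BirchSwinnertonDyer.BirchSwinnertonDyer.Theorems.ResidualThetaTransportAtTwoResidualSignedLambdaLowerCMAtTwoRhoLayerPairingCoeffSmul
import HarnessLib

/-!
# Station (E) of the KZ_g interior, input LIN-𝒪: the MATRIX `C`-step of the glue `locd₂` — `𝒸 (C a • x) i = ∑ j, N i j • 𝒸 x j` for
# `𝒸 = col^{⊕r} ∘ locd₂` — and Σ_pair `⟨a • y, Q⟩ = Σ_i Σ_j N i j ⟨y, Q_i δ_j⟩` in `ℤ_p` from the LEVELWISE balance

Route `ResidualThetaTransportAtTwo` (RTT), crux RSL_g `ResidualSignedLambdaLowerCMAtTwo` (stmt-BirchSwinnertonDyer-22608), line «onepair» v3f,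
registered KERNEL stub `stub_kzgTrivialisation` = station (E) (LEAD rtt-p2 g20 memo `V3F-KZG-INTERIOR-g20.md`). Width seat
`prover-bsd-wall-tp2-p2x-w2` g22 (`--supports 22608`, closes nothing by itself). THEOREMS ONLY (no `def`, no instance, no notation, no named fact,
no `sorry`); generic coefficients (`T : GaloisRep ℚ A M`, any `I : IwasawaH1DataCoeff T p κ γ`, any residue-pinned `pair`, any `locd₂` with the
layer formula). BSD is NOT proved by any of this; 22608 / 26074 / 24105 stay OPEN / HOLD.

PORT of the kernel-checked sketch `Cruxes/ResidualThetaCountLowerPureAtTwo/SketchB_sidea_k3_g19.lean` (stub-ideation k3 g19, «file B»;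
STUB-PLAN rev 26 rows 74/78), statements and proofs VERBATIM up to the namespace and ONE rename (`hPA_of_levelwise` ↦
`pair_smul_eq_sum_of_levelwise`); credit: stub-ideation k3 g19 (every statement and proof). A `Theorems/` file cannot import the sketch; the (E)
closer `…StationE.lean` imports this. Mirror of the landed SCALAR `C`-step `ThetaTransport.locd₂_C_smul` / `colTuple_locd₂_C_smul`
(`…RhoLayerPairingCoeffSmul.lean`) with a MATRIX `N ∈ M_r(ℤ_p)` in place of the scalar `c`:

* `locd₂_C_smul_single_matrix` — `locd₂ (C a • x) (single l q) = ∑ j, N l j · locd₂ x (single j q)` from `IwasawaH1DataCoeff.proj_C_smul` and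
  Σ_pair (`hPA : pair n (a • y) Q = ∑ i, ∑ j, N i j * pair n y (single j (Q i))`);
* `colTuple_locd₂_C_smul_matrix` — LIN-𝒪 for `𝒸 = col^{⊕r} ∘ locd₂`: `𝒸 (C a • x) i = ∑ j, N i j • 𝒸 x j` for any `ℤ_p`-linear `col` — the `hO`
  input of `PriceNode.exists_trivialisation` (p714652);
* `pair_smul_eq_sum_of_levelwise` — Σ_pair (`hPA`) in `ℤ_p` from the levelwise balance `⟨a • y, Q⟩_{n,p^k} = ⟨y, N_kᵀ Q⟩_{n,p^k}`,
  `N_k ≡ N (mod p^k)` (the binders `Nk`, `hNk`, `hbal` delivered at the pins by `SigmaBalance.rhoLayerPairingPk_smul_balance_pins`, p720103)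
  through `PadicInt.ext_of_toZModPow`.

References: [Kato2004Asterisque] §12.2 (p. 220), §13.8 (pp. 228–229), §17.13 (p. 279); [Kobayashi2003] §8 (8.20)–(8.23) (p. 18);
[PerrinRiou1994Invent] §3.6.1.
-/

set_option autoImplicit false
-- the Theorems namespace of this sub repeats the summit name by design (D-0017 nested layout)
set_option linter.dupNamespace false

noncomputable section

open scoped Classical

namespace Summit.BirchSwinnertonDyer.BirchSwinnertonDyer.Theorems.ThetaTransport

open CategoryTheory Field NumberField IsDedekindDomain WeierstrassCurve
  Literature.NumberTheory.EllipticCurves Literature.NumberTheory.GaloisRepresentations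
  Literature.NumberTheory.EllipticCurves.Kobayashi2003 Literature.NumberTheory.EllipticCurves.Sprung2012
  Literature.NumberTheory.EllipticCurves.GreenbergSelmer Literature.NumberTheory.EllipticCurves.CyclotomicLayer
  Literature.NumberTheory.EllipticCurves.Kato2004
  Literature.NumberTheory.GaloisCohomology ZpExtension

/-! ## The matrix `C`-step of the glue and LIN-𝒪 for `𝒸 = col^{⊕r} ∘ locd₂` (adapted from `SketchB_sidea_k3_g19.lean`, stub-ideation k3 g19) -/

section MatrixCStep

variable {p : ℕ} [Fact p.Prime] {A : Type} [CommRing A] [TopologicalSpace A] {M : Type} [AddCommGroup M] [Module A M]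
  [TopologicalSpace M] [IsTopologicalAddGroup M] [ContinuousSMul A M] {T : GaloisRep ℚ A M}
  {κ : ZpExtension ℚ p} {γ : absoluteGaloisGroup ℚ} (I : IwasawaH1DataCoeff T p κ γ)
  (W : WeierstrassCurve ℚ) (v : HeightOneSpectrum (𝓞 ℚ)) {r : ℕ}
  {pair : ∀ n : ℕ, H1 T (κ.layerSubgroup n) →+
    ((Fin r → localLayerPointsOfEmb κ (closureEmb (K := ℚ) (v.adicCompletion ℚ)) W n) →+ ℤ_[p])}
  {locd₂ : I.H →+ ((Fin r → localTowerPointsOfEmb κ (closureEmb (K := ℚ) (v.adicCompletion ℚ)) W) →+ ℤ_[p])}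
  {a : A} {N : Matrix (Fin r) (Fin r) ℤ_[p]}
  (hPA : ∀ (n : ℕ) (y : H1 T (κ.layerSubgroup n)) (Q : Fin r → localLayerPointsOfEmb κ (closureEmb (K := ℚ) (v.adicCompletion ℚ)) W n),
    pair n (a • y) Q = ∑ i, ∑ j, N i j * pair n y (Pi.single j (Q i)))
  (hlocd : ∀ (n : ℕ) (x : I.H) (Q : Fin r → localPoints W (v.adicCompletion ℚ))
    (hQ : ∀ i, Q i ∈ localLayerPointsOfEmb κ (closureEmb (K := ℚ) (v.adicCompletion ℚ)) W n),
    locd₂ x (fun i => ⟨Q i, localLayerPointsOfEmb_le_localTowerPointsOfEmb κ _ W n (hQ i)⟩) = pair n (I.proj n x) (fun i => ⟨Q i, hQ i⟩))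

/-- Components of `Pi.single l q` lie in the layer of `q`. [cite: Kobayashi2003, §8] -/
theorem coe_single_mem_layer {n : ℕ} (q : localTowerPointsOfEmb κ (closureEmb (K := ℚ) (v.adicCompletion ℚ)) W)
    (hq : (q : localPoints W (v.adicCompletion ℚ)) ∈ localLayerPointsOfEmb κ (closureEmb (K := ℚ) (v.adicCompletion ℚ)) W n)
    (l i : Fin r) :
    ((Pi.single l q : Fin r → localTowerPointsOfEmb κ (closureEmb (K := ℚ) (v.adicCompletion ℚ)) W) i :
        localPoints W (v.adicCompletion ℚ)) ∈ localLayerPointsOfEmb κ (closureEmb (K := ℚ) (v.adicCompletion ℚ)) W n := by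
  by_cases h : i = l
  · subst h; rwa [Pi.single_eq_same]
  · rw [Pi.single_eq_of_ne h]; exact zero_mem _

/-- `Pi.single` through the inclusion `E(ℚ_{n,v}) ⊆ E`. [cite: Kobayashi2003, §8] -/
theorem coe_single_layer {n : ℕ} (j i : Fin r) (x : localLayerPointsOfEmb κ (closureEmb (K := ℚ) (v.adicCompletion ℚ)) W n) :
    ((Pi.single j x : Fin r → localLayerPointsOfEmb κ (closureEmb (K := ℚ) (v.adicCompletion ℚ)) W n) i : localPoints W (v.adicCompletion ℚ)) =
      (Pi.single j (x : localPoints W (v.adicCompletion ℚ)) : Fin r → localPoints W (v.adicCompletion ℚ)) i := by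
  by_cases h : i = j
  · subst h; rw [Pi.single_eq_same, Pi.single_eq_same]
  · rw [Pi.single_eq_of_ne h, Pi.single_eq_of_ne h]; rfl

/-- `Pi.single` through the inclusion `E(ℚ_{∞,v}) ⊆ E`. [cite: Kobayashi2003, §8] -/
theorem coe_single_tower (j i : Fin r) (x : localTowerPointsOfEmb κ (closureEmb (K := ℚ) (v.adicCompletion ℚ)) W) :
    ((Pi.single j x : Fin r → localTowerPointsOfEmb κ (closureEmb (K := ℚ) (v.adicCompletion ℚ)) W) i : localPoints W (v.adicCompletion ℚ)) =
      (Pi.single j (x : localPoints W (v.adicCompletion ℚ)) : Fin r → localPoints W (v.adicCompletion ℚ)) i := by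
  by_cases h : i = j
  · subst h; rw [Pi.single_eq_same, Pi.single_eq_same]
  · rw [Pi.single_eq_of_ne h, Pi.single_eq_of_ne h]; rfl

include hPA hlocd in
/-- **The MATRIX `C`-step on coordinate functionals (PROVED): `locd₂ (C a • x) (single l q) = ∑ j, N l j · locd₂ x (single j q)`.**
Constants act through the `A`-structure of the levels (`IwasawaH1DataCoeff.proj_C_smul`), then Σ_pair (`hPA`); only the `l`-th outer summand survives.
[cite: Kato2004Asterisque, §12.2 (p. 220), §13.8 (p. 228)] -/
theorem locd₂_C_smul_single_matrix (x : I.H) (l : Fin r) (q : localTowerPointsOfEmb κ (closureEmb (K := ℚ) (v.adicCompletion ℚ)) W) :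
    locd₂ ((PowerSeries.C a : PowerSeries A) • x) (Pi.single l q) = ∑ j, N l j * locd₂ x (Pi.single j q) := by
  obtain ⟨n, hn⟩ := exists_common_layer W v (Pi.single l q)
  have hq : (q : localPoints W (v.adicCompletion ℚ)) ∈ localLayerPointsOfEmb κ (closureEmb (K := ℚ) (v.adicCompletion ℚ)) W n := by
    have := hn l; rwa [Pi.single_eq_same] at this
  have hmem : ∀ j i : Fin r, _ := coe_single_mem_layer W v q hq
  -- the layer-`n` tuples `Qn j = single j q` read in `E(ℚ_{n,v})^r`
  let Qn : Fin r → Fin r → localLayerPointsOfEmb κ (closureEmb (K := ℚ) (v.adicCompletion ℚ)) W n := fun j i =>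
    ⟨((Pi.single j q : Fin r → localTowerPointsOfEmb κ (closureEmb (K := ℚ) (v.adicCompletion ℚ)) W) i :
      localPoints W (v.adicCompletion ℚ)), hmem j i⟩
  have e : ∀ j : Fin r, (Pi.single j q : Fin r → localTowerPointsOfEmb κ (closureEmb (K := ℚ) (v.adicCompletion ℚ)) W) = fun i =>
      (⟨((Pi.single j q : Fin r → localTowerPointsOfEmb κ (closureEmb (K := ℚ) (v.adicCompletion ℚ)) W) i : localPoints W (v.adicCompletion ℚ)),
        localLayerPointsOfEmb_le_localTowerPointsOfEmb κ _ W n (hmem j i)⟩ :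
          localTowerPointsOfEmb κ (closureEmb (K := ℚ) (v.adicCompletion ℚ)) W) :=
    fun j => funext fun i => Subtype.ext rfl
  have hQn0 : ∀ i, i ≠ l → Qn l i = 0 := fun i hi => Subtype.ext (by
    show ((Pi.single l q : Fin r → localTowerPointsOfEmb κ (closureEmb (K := ℚ) (v.adicCompletion ℚ)) W) i :
      localPoints W (v.adicCompletion ℚ)) = ((0 : localLayerPointsOfEmb κ (closureEmb (K := ℚ) (v.adicCompletion ℚ)) W n) : localPoints W (v.adicCompletion ℚ))
    rw [Pi.single_eq_of_ne hi]; rfl)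
  have hQll : ((Qn l l : localLayerPointsOfEmb κ (closureEmb (K := ℚ) (v.adicCompletion ℚ)) W n) : localPoints W (v.adicCompletion ℚ)) =
      (q : localPoints W (v.adicCompletion ℚ)) := by
    show ((Pi.single l q : Fin r → localTowerPointsOfEmb κ (closureEmb (K := ℚ) (v.adicCompletion ℚ)) W) l :
      localPoints W (v.adicCompletion ℚ)) = (q : localPoints W (v.adicCompletion ℚ))
    rw [Pi.single_eq_same]
  have hQn : ∀ j, Pi.single j (Qn l l) = Qn j := by
    intro j
    funext i
    apply Subtype.ext
    rw [coe_single_layer W v j i (Qn l l), hQll]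
    show (Pi.single j (q : localPoints W (v.adicCompletion ℚ)) : Fin r → localPoints W (v.adicCompletion ℚ)) i =
      ((Pi.single j q : Fin r → localTowerPointsOfEmb κ (closureEmb (K := ℚ) (v.adicCompletion ℚ)) W) i : localPoints W (v.adicCompletion ℚ))
    rw [coe_single_tower W v j i q]
  calc locd₂ ((PowerSeries.C a : PowerSeries A) • x) (Pi.single l q)
      = pair n (a • I.proj n x) (Qn l) := by rw [e l, hlocd n _ _ (hmem l), I.proj_C_smul]
    _ = ∑ i, ∑ j, N i j * pair n (I.proj n x) (Pi.single j (Qn l i)) := hPA n _ _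
    _ = ∑ j, N l j * pair n (I.proj n x) (Pi.single j (Qn l l)) := by
        refine Finset.sum_eq_single l (fun i _ hi => ?_) (fun h => absurd (Finset.mem_univ l) h)
        refine Finset.sum_eq_zero fun j _ => ?_
        rw [hQn0 i hi, Pi.single_zero, map_zero, mul_zero]
    _ = ∑ j, N l j * locd₂ x (Pi.single j q) := Finset.sum_congr rfl fun j _ => by rw [hQn j, e j, hlocd n x _ (hmem j)]

include hPA hlocd in
/-- **LIN-𝒪 for `𝒸 = col^{⊕r} ∘ locd₂` (PROVED): `𝒸 (C a • x) i = ∑ j, N i j • 𝒸 x j`** for any `ℤ_p`-linear `col` — the `hO` input of file A §3 at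
`V = Λ = ℤ_p⟦X⟧` (`N i j • s = C (N i j) * s`). Matrix twin of `colTuple_locd₂_C_smul`. [cite: Kato2004Asterisque, §13.8 (p. 228), §17.13 (p. 279)] -/
theorem colTuple_locd₂_C_smul_matrix {V : Type*} [AddCommGroup V] [Module ℤ_[p] V]
    (col : (localTowerPointsOfEmb κ (closureEmb (K := ℚ) (v.adicCompletion ℚ)) W →+ ℤ_[p]) →ₗ[ℤ_[p]] V) (x : I.H) :
    (fun i : Fin r => col ((locd₂ ((PowerSeries.C a : PowerSeries A) • x)).comp
        (AddMonoidHom.single (fun _ : Fin r => ↥(localTowerPointsOfEmb κ (closureEmb (K := ℚ) (v.adicCompletion ℚ)) W)) i))) =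
      fun i : Fin r => ∑ j, N i j • col ((locd₂ x).comp
        (AddMonoidHom.single (fun _ : Fin r => ↥(localTowerPointsOfEmb κ (closureEmb (K := ℚ) (v.adicCompletion ℚ)) W)) j)) := by
  funext i
  have h : (locd₂ ((PowerSeries.C a : PowerSeries A) • x)).comp
        (AddMonoidHom.single (fun _ : Fin r => ↥(localTowerPointsOfEmb κ (closureEmb (K := ℚ) (v.adicCompletion ℚ)) W)) i) =
      ∑ j, N i j • (locd₂ x).comp
        (AddMonoidHom.single (fun _ : Fin r => ↥(localTowerPointsOfEmb κ (closureEmb (K := ℚ) (v.adicCompletion ℚ)) W)) j) := by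
    ext q
    rw [AddMonoidHom.comp_apply, AddMonoidHom.single_apply, locd₂_C_smul_single_matrix I W v hPA hlocd, AddMonoidHom.finsetSum_apply]
    exact Finset.sum_congr rfl fun j _ => by
      rw [AddMonoidHom.smul_apply, AddMonoidHom.comp_apply, AddMonoidHom.single_apply, smul_eq_mul]
  rw [h, map_sum]
  exact Finset.sum_congr rfl fun j _ => by rw [map_smul]

/-! ## Σ_pair from the LEVELWISE balance (k2-g19's «H9-loc», torsion-levelwise) — packaging by `PadicInt.ext_of_toZModPow` -/

/-- **Σ_pair (`hPA`) from the levelwise `𝒪`-balance through `Θ` (PROVED packaging).** If `pair n` is residue-wise the level-`p^k` pairings `ePk n k`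
(the `OnePairPins.hpair` pin), and at each level the constant `a` moves to the POINT side through the transpose of an `ℕ`-matrix `Nk k` reducing to
`N mod p^k` (the currency of the landed `ThetaTransport.decomp_equivariant_addMonoidHom_pi_primary_eq_sum_nsmul`), then `hPA` holds in `ℤ_p`.
What is left OPEN is exactly `hbal` for the pinned `rhoLayerPairingPk` (Σ_bal). [cite: Kato2004Asterisque, §13.8 (p. 228)] [cite: PerrinRiou1994Invent, §3.6.1] -/
theorem pair_smul_eq_sum_of_levelwise
    (ePk : ∀ n k : ℕ, H1 T (κ.layerSubgroup n) →+
      ((Fin r → localLayerPointsOfEmb κ (closureEmb (K := ℚ) (v.adicCompletion ℚ)) W n) →+ ZMod (p ^ k)))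
    (hpair : ∀ (n k : ℕ) (x : H1 T (κ.layerSubgroup n)) (Q : Fin r → localLayerPointsOfEmb κ (closureEmb (K := ℚ) (v.adicCompletion ℚ)) W n),
      PadicInt.toZModPow k (pair n x Q) = ePk n k x Q)
    (Nk : ℕ → Matrix (Fin r) (Fin r) ℕ) (hNk : ∀ (k : ℕ) (i j : Fin r), ((Nk k i j : ℕ) : ZMod (p ^ k)) = PadicInt.toZModPow k (N i j))
    (hbal : ∀ (n k : ℕ) (y : H1 T (κ.layerSubgroup n)) (Q : Fin r → localLayerPointsOfEmb κ (closureEmb (K := ℚ) (v.adicCompletion ℚ)) W n),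
      ePk n k (a • y) Q = ePk n k y (fun j => ∑ i, Nk k i j • Q i))
    (n : ℕ) (y : H1 T (κ.layerSubgroup n)) (Q : Fin r → localLayerPointsOfEmb κ (closureEmb (K := ℚ) (v.adicCompletion ℚ)) W n) :
    pair n (a • y) Q = ∑ i, ∑ j, N i j * pair n y (Pi.single j (Q i)) := by
  refine PadicInt.ext_of_toZModPow.mp fun k => ?_
  have htuple : (fun j => ∑ i, Nk k i j • Q i) =
      ∑ i, ∑ j, (Pi.single j (Nk k i j • Q i) : Fin r → localLayerPointsOfEmb κ (closureEmb (K := ℚ) (v.adicCompletion ℚ)) W n) := by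
    funext j₀
    rw [Finset.sum_apply]
    refine Finset.sum_congr rfl fun i _ => ?_
    rw [Finset.sum_apply, Finset.sum_eq_single j₀ (fun j _ hj => Pi.single_eq_of_ne' hj _) (fun h => absurd (Finset.mem_univ j₀) h),
      Pi.single_eq_same]
  rw [hpair, hbal, htuple, map_sum, map_sum]
  refine Finset.sum_congr rfl fun i _ => ?_
  rw [map_sum, map_sum]
  refine Finset.sum_congr rfl fun j _ => ?_
  rw [Pi.single_smul, map_nsmul, nsmul_eq_mul, map_mul, hpair, ← hNk]

end MatrixCStep

end Summit.BirchSwinnertonDyer.BirchSwinnertonDyer.Theorems.ThetaTransport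

end
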